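import Mathlib
import Summits.Ventures.HodgeRepro.PeriodCloserC7Stability
import Summits.Ventures.HodgeRepro.OcticCMPointS3

/-!
# OcticCMPointDualModel — the ring `𝒪/𝔭²` at the ramified places `𝔭₁, 𝔭₂ | 5` of the octic point, transcribed

Blind re-derivation cell `pub-hodge-repro`, seat night-2 (gen 4).  Target tree path
`lean/Summits/Ventures/HodgeRepro/OcticCMPointDualModel.lean`.

**The transcription.**  At `𝔭₁, 𝔭₂ | 5` of `E = ℚ(ζ₅, √(4+√5))` the completion is `K_v = ℚ₅(ζ₅)` over
`k_v = ℚ₅(√5)` (`OcticCMPointS3.lean`: `octic_p1 = ⟨5, 2, 1, 5, 5⟩`), totally ramified of degree `4` over `ℚ₅`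
with the trace-zero uniformiser `ϖ = ζ₅ − ζ₅⁻¹` (`σ ϖ = −ϖ` for the conjugation `σ : ζ₅ ↦ ζ₅⁻¹`) and residue
field `𝔽₅`.  Since `5 ∈ 𝔭⁴`, the ring `𝒪/𝔭²` has characteristic `5` and is `𝔽₅[ϖ]/(ϖ²) = 𝔽₅[ε]` — Mathlib's
`DualNumber (ZMod 5)` — with `σ` acting by `a + bε ↦ a − bε` (`σ` fixes the Teichmüller lifts, negates `ϖ`).

The hypotheses of the gen-1 / gen-3 model theorems (`PeriodCloserC7Stability.lean`, `GaussSumProductLocal.lean`,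
`OcticCMPointConjDual.lean`, `OcticCMPointDeepSign.lean`) become THEOREMS of that ring, for a general finite
field `k` of coefficients (`k = ZMod 5` at `𝔭₁, 𝔭₂`): `maxIdeal k` with `hloc` (`x ∈ 𝔪 ↔ ¬ IsUnit x`) and
`𝔪 · 𝔪 = 0`; the induced additive character `psiTilde ψ₀ : a + bε ↦ ψ₀(b)` — primitive when `ψ₀` is, with
`𝔪`-annihilator exactly `𝔪` (`psiAnn_iff`, giving `hA` and `hsq`), and `ψ̃ ∘ σ = ψ̃ ∘ (−1 ·)` = the hypothesis
of `conjDual_ramified` for EVEN `n = ν + 2` (`psiTilde_conj_pow`; `ν(ψ_δ)` is even at a tamely ramified place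
with a trace-zero `δ`, gen 3 `NIGHT-2-g3.md` §3c); the conjugation `conj k` as a ring automorphism; EVERY
character of `(𝒪/𝔭²)^× = k^× × (1 + 𝔪)` as `tameWild θ β ψ₀ : a + bε ↦ θ(a) ψ₀(β b / a)` (conductor exactly
`2` iff `β ≠ 0`, `tameWild_hprim`; conjugate-dual iff `θ² = 1`, `tameWild_conjDualUnit`); and **the Gauss sum
evaluated**, `𝔤(ω, ψ̃) = |k| · θ(β)^{−1}` for `β ≠ 0` (`gauss_tameWild`; the inner sum over `b` is
`|k| · [a = β]` by `AddChar.sum_mulShift`).  Hence Kudla's `ε(s, ω, ψ)` of Prop. 3.8 (ii)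
(`book:editornd-introduction-langlands-program` p0109:L3–L11; on the model `eps κ n ω ψ̃ = ω(ϖ)^n κ 𝔤(ω, ψ̃)`)
is `ω(ϖ)^n · κ |k| · θ(β)^{−1}` (`eps_tameWild`), and with the `s = ½` constant `κ = |R|^{−1/2} = |k|^{−1}`
(`OcticCMPointKappa.lean`; `sqrt_card_dual_p5`) it is the SIGN `ω(ϖ)^n θ(β)` for a conjugate-dual `ω`
(`eps_tameWild_sign`).

**What this is not.**  The four characters `χ′_j` of the octic face are on no page; the local root numbers are
evaluated for the WHOLE family of conductor-`2` characters at `𝔭₁, 𝔭₂`, not for a particular one.  The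
conductor-`c` rings for `c ≥ 3` (`𝔽₅[ϖ]/(ϖ^c)`) are not transcribed here.  Nothing here says anything about
the status of the Hodge conjecture for CM abelian varieties, which is NOT proved.
-/

set_option autoImplicit false

noncomputable section

open Finset TrivSqZeroExt

namespace Summit.Ventures.HodgeRepro.PeriodCloser

open GaussSumStability

namespace DualModel

/-- `k[ε]` is finite (it is `k × k` as a type). -/
instance instFintypeDualNumber {k : Type} [Fintype k] : Fintype (DualNumber k) :=
  inferInstanceAs (Fintype (k × k))

/-- `k[ε]` has decidable equality (it is `k × k` as a type). -/
instance instDecidableEqDualNumber {k : Type} [DecidableEq k] : DecidableEq (DualNumber k) :=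
  inferInstanceAs (DecidableEq (k × k))

/-- `|k[ε]| = |k|²`. -/
theorem card_dualNumber {k : Type} [Fintype k] : Fintype.card (DualNumber k) = Fintype.card k ^ 2 := by
  change Fintype.card (k × k) = _
  rw [Fintype.card_prod, sq]

variable {k : Type} [Field k]

/-! ### The maximal ideal `𝔪 = (ε)` and the local-ring hypothesis -/

/-- **The maximal ideal** `𝔪 = {a + bε : a = 0} = (ε)` of `k[ε]` (the transcription of `𝔭/𝔭²`). -/
def maxIdeal (k : Type) [Field k] : Ideal (DualNumber k) where
  carrier := {x | x.fst = 0}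
  add_mem' {x y} hx hy := by
    simp only [Set.mem_setOf_eq] at hx hy ⊢
    rw [fst_add, hx, hy, add_zero]
  zero_mem' := by
    simp only [Set.mem_setOf_eq, fst_zero]
  smul_mem' c {x} hx := by
    simp only [Set.mem_setOf_eq] at hx ⊢
    rw [smul_eq_mul, fst_mul, hx, mul_zero]

/-- Membership in `𝔪`: the constant term vanishes. -/
theorem mem_maxIdeal_iff (x : DualNumber k) : x ∈ maxIdeal k ↔ x.fst = 0 := Iff.rfl

/-- **`hloc`**: `k[ε]` is local with maximal ideal `𝔪` — `x ∈ 𝔪 ↔ ¬ IsUnit x` (`isUnit_iff_isUnit_fst`). -/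
theorem hloc (x : DualNumber k) : x ∈ maxIdeal k ↔ ¬ IsUnit x := by
  rw [mem_maxIdeal_iff, isUnit_iff_isUnit_fst, isUnit_iff_ne_zero, not_not]

/-- `𝔪 · 𝔪 = 0`: `(bε)(dε) = bd ε² = 0`. -/
theorem mul_eq_zero_of_mem {x y : DualNumber k} (hx : x ∈ maxIdeal k) (hy : y ∈ maxIdeal k) : x * y = 0 := by
  rw [mem_maxIdeal_iff] at hx hy
  ext
  · rw [fst_mul, hx, zero_mul, fst_zero]
  · rw [DualNumber.snd_mul, hx, hy, zero_mul, mul_zero, add_zero, snd_zero]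

/-- `inr b = bε ∈ 𝔪`. -/
theorem inr_mem_maxIdeal (b : k) : (inr b : DualNumber k) ∈ maxIdeal k := by
  rw [mem_maxIdeal_iff, fst_inr]

/-! ### The induced additive character `ψ̃(a + bε) = ψ₀(b)` -/

/-- **The induced additive character** `ψ̃ : k[ε] → ℂ^×`, `a + bε ↦ ψ₀(b)`, for a character `ψ₀` of `(k, +)`
(the transcription of `ψ̃(y) = ψ_δ(ϖ^{−n} y)` on `𝒪/𝔭²`; see `psiTilde_conj`). -/
def psiTilde (ψ₀ : AddChar k ℂ) : AddChar (DualNumber k) ℂ :=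
  ψ₀.compAddMonoidHom (sndHom k k : DualNumber k →ₗ[k] k).toAddMonoidHom

/-- `ψ̃(x) = ψ₀(x.snd)`. -/
theorem psiTilde_apply (ψ₀ : AddChar k ℂ) (x : DualNumber k) : psiTilde ψ₀ x = ψ₀ x.snd := rfl

/-- **`ψ̃` is primitive when `ψ₀` is**: for `a = a₁ + a₂ε ≠ 0` the shift `ψ̃(a ·)` is non-trivial — on `yε`
when `a₁ ≠ 0` (`ψ̃(a · yε) = ψ₀(a₁ y)`), on `y` when `a₁ = 0` (`ψ̃(a · y) = ψ₀(a₂ y)`). -/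
theorem psiTilde_isPrimitive (ψ₀ : AddChar k ℂ) (h₀ : ψ₀.IsPrimitive) : (psiTilde ψ₀).IsPrimitive := by
  intro a ha h1
  have key : ∀ x : DualNumber k, psiTilde ψ₀ (a * x) = 1 := fun x => by
    have := DFunLike.congr_fun h1 x
    rwa [AddChar.mulShift_apply, AddChar.one_apply] at this
  by_cases hf : a.fst = 0
  · have hs : a.snd ≠ 0 := fun hs => ha (TrivSqZeroExt.ext (by rw [hf, fst_zero]) (by rw [hs, snd_zero]))
    apply h₀ hs
    ext y
    rw [AddChar.mulShift_apply, AddChar.one_apply]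
    have := key (inl y)
    rwa [psiTilde_apply, DualNumber.snd_mul, snd_inl, fst_inl, mul_zero, zero_add] at this
  · apply h₀ hf
    ext y
    rw [AddChar.mulShift_apply, AddChar.one_apply]
    have := key (inr y)
    rwa [psiTilde_apply, DualNumber.snd_mul, snd_inr, fst_inr, mul_zero, add_zero] at this

/-- **The `ψ̃`-annihilator of `𝔪` is `𝔪`** (for a primitive `ψ₀`): `t = t₁ + t₂ε` kills `𝔪` under `ψ̃` iff
`ψ₀(t₁ y) = 1` for all `y` iff `t₁ = 0` — the transcription of `A = 𝔭^{c−1}/𝔭^c` at `c = 2`. -/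
theorem psiAnn_iff (ψ₀ : AddChar k ℂ) (h₀ : ψ₀.IsPrimitive) (t : DualNumber k) :
    PsiAnn (psiTilde ψ₀) (maxIdeal k) t ↔ t ∈ maxIdeal k := by
  constructor
  · intro ht
    by_contra hf
    rw [mem_maxIdeal_iff] at hf
    apply h₀ hf
    ext y
    rw [AddChar.mulShift_apply, AddChar.one_apply]
    have := ht (inr y) (inr_mem_maxIdeal y)
    rwa [psiTilde_apply, DualNumber.snd_mul, snd_inr, fst_inr, mul_zero, add_zero] at this
  · intro ht z hz
    rw [mul_eq_zero_of_mem ht hz, AddChar.map_zero_eq_one]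

/-- **`hA`**: the annihilator lies in `𝔪`. -/
theorem hA (ψ₀ : AddChar k ℂ) (h₀ : ψ₀.IsPrimitive) :
    ∀ t, PsiAnn (psiTilde ψ₀) (maxIdeal k) t → t ∈ maxIdeal k :=
  fun t ht => (psiAnn_iff ψ₀ h₀ t).1 ht

/-- **`hsq`**: the annihilator has square zero. -/
theorem hsq (ψ₀ : AddChar k ℂ) (h₀ : ψ₀.IsPrimitive) :
    ∀ t t', PsiAnn (psiTilde ψ₀) (maxIdeal k) t → PsiAnn (psiTilde ψ₀) (maxIdeal k) t' → t * t' = 0 :=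
  fun t t' ht ht' => mul_eq_zero_of_mem ((psiAnn_iff ψ₀ h₀ t).1 ht) ((psiAnn_iff ψ₀ h₀ t').1 ht')

/-- The hypothesis `hI` of `eps_mul_eq` / `eps_E3_of_N2` (`PeriodCloserC7Stability.lean`) for `I = 𝔪`. -/
theorem hI : ∀ z ∈ maxIdeal k, ∀ z' ∈ maxIdeal k, z * z' = 0 :=
  fun _ hz _ hz' => mul_eq_zero_of_mem hz hz'

/-! ### The conjugation `σ : a + bε ↦ a − bε` -/

/-- **The conjugation** of `𝒪/𝔭²` for a trace-zero uniformiser (`σ ϖ = −ϖ`, `σ` trivial on the Teichmüller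
lifts): `a + bε ↦ a − bε`. -/
def conj (k : Type) [Field k] : DualNumber k ≃+* DualNumber k where
  toFun x := (x.fst, -x.snd)
  invFun x := (x.fst, -x.snd)
  left_inv x := by ext <;> simp
  right_inv x := by ext <;> simp
  map_mul' x y := by
    ext
    · simp only [fst_mul, fst_mk]
    · simp only [DualNumber.snd_mul, snd_mk, fst_mk]
      ring
  map_add' x y := by
    ext
    · simp only [fst_add, fst_mk]
    · simp only [snd_add, snd_mk]
      ring

/-- `(σ x).fst = x.fst`. -/
theorem fst_conj (x : DualNumber k) : (conj k x).fst = x.fst := rfl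

/-- `(σ x).snd = −x.snd`. -/
theorem snd_conj (x : DualNumber k) : (conj k x).snd = -x.snd := rfl

/-- `σ ε = −ε`: the uniformiser has trace zero. -/
theorem conj_eps : conj k (DualNumber.eps : DualNumber k) = -DualNumber.eps := by
  ext
  · rw [fst_conj, fst_neg, DualNumber.fst_eps, neg_zero]
  · rw [snd_conj, snd_neg]

/-- `σ` fixes the Teichmüller lifts `inl a`. -/
theorem conj_inl (a : k) : conj k (inl a : DualNumber k) = inl a := by
  ext
  · rw [fst_conj, fst_inl]
  · rw [snd_conj, snd_inl, neg_zero]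

/-- **`ψ̃ ∘ σ = ψ̃ ∘ (−1 ·)`**: `ψ̃(σ x) = ψ₀(−x.snd) = ψ̃(−x)`. -/
theorem psiTilde_conj (ψ₀ : AddChar k ℂ) (x : DualNumber k) : psiTilde ψ₀ (conj k x) = psiTilde ψ₀ (-x) := by
  rw [psiTilde_apply, psiTilde_apply, snd_conj, snd_neg]

/-- **The hypothesis `hψ` of `conjDual_ramified`** (`OcticCMPointConjDual.lean`) for EVEN `n`:
`ψ̃(σ x) = ψ̃((−1)^{n+1} x)`. -/
theorem psiTilde_conj_pow (ψ₀ : AddChar k ℂ) (n : ℕ) (hn : Even n) (x : DualNumber k) :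
    psiTilde ψ₀ (conj k x) = psiTilde ψ₀ ((-1 : DualNumber k) ^ (n + 1) * x) := by
  rw [psiTilde_conj, hn.add_one.neg_one_pow, neg_one_mul]

/-! ### Every character of `(𝒪/𝔭²)^× = k^× × (1 + 𝔪)`: tame part times wild part -/

section TameWild

variable [DecidableEq k]

/-- **The characters of `k[ε]^×`**: `a + bε ↦ θ(a) · ψ₀(β b / a)` for `a ≠ 0` (and `0` off the units) — the
tame character `θ` of `k^×` on the Teichmüller lifts times the wild character `1 + bε ↦ ψ₀(β b)` of
`1 + 𝔪 ≅ (k, +)`. -/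
def tameWild (θ : MulChar k ℂ) (β : k) (ψ₀ : AddChar k ℂ) : MulChar (DualNumber k) ℂ where
  toFun x := if x.fst = 0 then 0 else θ x.fst * ψ₀ (β * x.snd / x.fst)
  map_one' := by
    simp only [fst_one, one_ne_zero, if_false, snd_one, mul_zero, zero_div, AddChar.map_zero_eq_one,
      MulChar.map_one, mul_one]
  map_mul' x y := by
    by_cases hx : x.fst = 0
    · simp only [fst_mul, hx, zero_mul, if_true]
    by_cases hy : y.fst = 0
    · simp only [fst_mul, hy, mul_zero, if_true]
    have hxy : x.fst * y.fst ≠ 0 := mul_ne_zero hx hy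
    simp only [fst_mul, DualNumber.snd_mul, hxy, hx, hy, if_false, map_mul]
    rw [show β * (x.fst * y.snd + x.snd * y.fst) / (x.fst * y.fst) =
        β * x.snd / x.fst + β * y.snd / y.fst by field_simp; ring, AddChar.map_add_eq_mul]
    ring
  map_nonunit' x hx := by
    rw [isUnit_iff_isUnit_fst, isUnit_iff_ne_zero, not_not] at hx
    simp only [hx, if_true]

/-- The value of `tameWild`. -/
theorem tameWild_apply (θ : MulChar k ℂ) (β : k) (ψ₀ : AddChar k ℂ) (x : DualNumber k) :
    tameWild θ β ψ₀ x = if x.fst = 0 then 0 else θ x.fst * ψ₀ (β * x.snd / x.fst) := rfl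

/-- On `1 + bε`: `tameWild θ β ψ₀ (1 + bε) = ψ₀(β b)`. -/
theorem tameWild_one_add_inr (θ : MulChar k ℂ) (β : k) (ψ₀ : AddChar k ℂ) (b : k) :
    tameWild θ β ψ₀ (1 + inr b) = ψ₀ (β * b) := by
  rw [tameWild_apply, fst_add, fst_one, fst_inr, add_zero, snd_add, snd_one, snd_inr, zero_add]
  simp only [one_ne_zero, if_false, MulChar.map_one, div_one, one_mul]

/-- On the Teichmüller lift `inl a`: `tameWild θ β ψ₀ (inl a) = θ(a)`. -/
theorem tameWild_inl (θ : MulChar k ℂ) (β : k) (ψ₀ : AddChar k ℂ) (a : k) :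
    tameWild θ β ψ₀ (inl a) = θ a := by
  rw [tameWild_apply, fst_inl, snd_inl]
  by_cases ha : a = 0
  · simp only [ha, if_true, MulChar.map_zero]
  · simp only [ha, if_false, mul_zero, zero_div, AddChar.map_zero_eq_one, mul_one]

/-- **Conductor exactly `2`** (the hypothesis `hprim` of the product formula, `GaussSumProductLocal.lean`):
for `β ≠ 0` and `ψ₀` primitive there is `z₀ ∈ A = 𝔪` with `ω(1 + z₀) ≠ 1`. -/
theorem tameWild_hprim (θ : MulChar k ℂ) (β : k) (hβ : β ≠ 0) (ψ₀ : AddChar k ℂ) (h₀ : ψ₀.IsPrimitive) :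
    ∃ z₀, PsiAnn (psiTilde ψ₀) (maxIdeal k) z₀ ∧ tameWild θ β ψ₀ (1 + z₀) ≠ 1 := by
  obtain ⟨b, hb⟩ := AddChar.ne_one_iff.1 (h₀ hβ)
  rw [AddChar.mulShift_apply] at hb
  exact ⟨inr b, (psiAnn_iff ψ₀ h₀ _).2 (inr_mem_maxIdeal b), by rwa [tameWild_one_add_inr]⟩

/-- **Conjugate duality of the units** (`ConjDualUnit` of `OcticCMPointTameDual.lean`, the hypothesis `hω` of
`conjDual_ramified`): `ω ∘ σ = ω⁻¹` for `ω = tameWild θ β ψ₀` as soon as `θ(a)² = 1` on `k^×` (the wild part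
is automatically conjugate-dual: `ψ₀(−β b) = ψ₀(β b)^{−1}`). -/
theorem tameWild_conjDualUnit (θ : MulChar k ℂ) (hθ : ∀ a : k, a ≠ 0 → θ a * θ a = 1) (β : k)
    (ψ₀ : AddChar k ℂ) (x : DualNumber k) : tameWild θ β ψ₀ (conj k x) = (tameWild θ β ψ₀)⁻¹ x := by
  rw [MulChar.inv_apply_eq_inv', tameWild_apply, tameWild_apply, fst_conj, snd_conj]
  by_cases hx : x.fst = 0
  · simp only [hx, if_true, inv_zero]
  · simp only [hx, if_false, mul_inv, mul_neg, neg_div, AddChar.map_neg_eq_inv]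
    congr 1
    exact eq_inv_of_mul_eq_one_left (hθ x.fst hx)

/-- **`ω(−1)`** for `ω = tameWild θ β ψ₀`: `θ(−1)` (the wild part is trivial on the Teichmüller lifts). -/
theorem tameWild_neg_one (θ : MulChar k ℂ) (β : k) (ψ₀ : AddChar k ℂ) : tameWild θ β ψ₀ (-1) = θ (-1) := by
  rw [show (-1 : DualNumber k) = inl (-1) by rw [inl_neg, inl_one], tameWild_inl]

end TameWild

/-! ### The Gauss sum of a conductor-`2` character, evaluated -/

section GaussSum

variable [DecidableEq k] [Fintype k]

/-- **The Gauss sum evaluated**: for `ω = tameWild θ β ψ₀` with `β ≠ 0` and `ψ₀` primitive,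
`∑_{x ∈ k[ε]} ω^{−1}(x) ψ̃(x) = |k| · θ(β)^{−1}`: over `x = a + bε`, `a ≠ 0`, the summand is
`θ(a)^{−1} ψ₀(b (1 − β/a))`, whose sum over `b` is `|k| · [a = β]` (`AddChar.sum_mulShift`). -/
theorem gaussSum_tameWild_inv (θ : MulChar k ℂ) (β : k) (hβ : β ≠ 0) (ψ₀ : AddChar k ℂ) (h₀ : ψ₀.IsPrimitive) :
    gaussSum (tameWild θ β ψ₀)⁻¹ (psiTilde ψ₀) = (Fintype.card k : ℂ) * (θ β)⁻¹ := by
  unfold gaussSum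
  -- the sum over `k[ε] = k × k`
  change ∑ x : k × k, (tameWild θ β ψ₀)⁻¹ (x : DualNumber k) * psiTilde ψ₀ (x : DualNumber k) = _
  rw [Fintype.sum_prod_type]
  -- the summand at `(a, b)`
  have hterm : ∀ a b : k, (tameWild θ β ψ₀)⁻¹ ((a, b) : DualNumber k) * psiTilde ψ₀ ((a, b) : DualNumber k) =
      if a = 0 then 0 else (θ a)⁻¹ * ψ₀ (b * (1 - β / a)) := by
    intro a b
    rw [MulChar.inv_apply_eq_inv', tameWild_apply, psiTilde_apply, fst_mk, snd_mk]
    by_cases ha : a = 0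
    · simp only [ha, if_true, inv_zero, zero_mul]
    · simp only [ha, if_false, mul_inv]
      rw [← AddChar.map_neg_eq_inv, mul_assoc, ← AddChar.map_add_eq_mul]
      congr 2
      field_simp
      ring
  simp_rw [hterm]
  -- the inner sums
  have hinner : ∀ a : k, (∑ b : k, if a = 0 then (0 : ℂ) else (θ a)⁻¹ * ψ₀ (b * (1 - β / a))) =
      if a = β then (Fintype.card k : ℂ) * (θ β)⁻¹ else 0 := by
    intro a
    by_cases ha : a = 0
    · have hne : (0 : k) ≠ β := fun h => hβ h.symm
      simp only [ha, if_true, Finset.sum_const_zero, hne, if_false]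
    · simp only [ha, if_false]
      rw [← Finset.mul_sum, AddChar.sum_mulShift _ h₀]
      by_cases hab : a = β
      · have h1 : (1 : k) - β / a = 0 := by rw [hab, div_self hβ, sub_self]
        rw [if_pos h1, if_pos hab, hab]
        ring
      · have h1 : (1 : k) - β / a ≠ 0 := by
          intro h
          apply hab
          have : β / a = 1 := by linear_combination -h
          rw [div_eq_one_iff_eq ha] at this
          exact this.symm
        rw [if_neg h1, if_neg hab, Nat.cast_zero, mul_zero]
  simp_rw [hinner]
  rw [Finset.sum_ite_eq' Finset.univ β]
  simp only [Finset.mem_univ, if_true]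

/-- **The Gauss sum of the model** (`LocalChar.gauss`, `PeriodCloserC7Stability.lean`) of a conductor-`2`
character `ω = ⟨tameWild θ β ψ₀, ϖ-value⟩`: `𝔤(ω, ψ̃) = |k| · θ(β)^{−1}`. -/
theorem gauss_tameWild (θ : MulChar k ℂ) (β : k) (hβ : β ≠ 0) (ψ₀ : AddChar k ℂ) (h₀ : ψ₀.IsPrimitive)
    (piVal : ℂ) :
    LocalChar.gauss (⟨tameWild θ β ψ₀, piVal⟩ : LocalChar (DualNumber k)) (psiTilde ψ₀) =
      (Fintype.card k : ℂ) * (θ β)⁻¹ :=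
  gaussSum_tameWild_inv θ β hβ ψ₀ h₀

/-- **Kudla's `ε(s, ω, ψ)` of Prop. 3.8 (ii) on the model, evaluated** (p0109:L3–L11; `eps κ n ω ψ̃ =
ω(ϖ)^n κ 𝔤(ω, ψ̃)`): for `ω = ⟨tameWild θ β ψ₀, ϖ-value⟩`, `ε = ω(ϖ)^n · κ · |k| · θ(β)^{−1}`. -/
theorem eps_tameWild (κ : ℂ) (n : ℕ) (θ : MulChar k ℂ) (β : k) (hβ : β ≠ 0) (ψ₀ : AddChar k ℂ)
    (h₀ : ψ₀.IsPrimitive) (piVal : ℂ) :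
    LocalChar.eps κ n (⟨tameWild θ β ψ₀, piVal⟩ : LocalChar (DualNumber k)) (psiTilde ψ₀) =
      piVal ^ n * κ * ((Fintype.card k : ℂ) * (θ β)⁻¹) := by
  unfold LocalChar.eps
  rw [gauss_tameWild θ β hβ ψ₀ h₀ piVal]

/-- **The sign at `s = ½`**: with `κ · |k| = 1` (`κ = |R|^{−1/2} = |k|^{−1}`, `OcticCMPointKappa.lean`),
`θ(β)² = 1` and `ω(ϖ)^n = ±1`, the local root number of the conductor-`2` character is `ω(ϖ)^n θ(β) = ±1`. -/
theorem eps_tameWild_sign (κ : ℂ) (hκ : κ * (Fintype.card k : ℂ) = 1) (n : ℕ) (θ : MulChar k ℂ) (β : k)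
    (hβ : β ≠ 0) (hθ : θ β * θ β = 1) (ψ₀ : AddChar k ℂ) (h₀ : ψ₀.IsPrimitive) (piVal : ℂ)
    (hπ : piVal ^ n = 1 ∨ piVal ^ n = -1) :
    LocalChar.eps κ n (⟨tameWild θ β ψ₀, piVal⟩ : LocalChar (DualNumber k)) (psiTilde ψ₀) = 1 ∨
      LocalChar.eps κ n (⟨tameWild θ β ψ₀, piVal⟩ : LocalChar (DualNumber k)) (psiTilde ψ₀) = -1 := by
  rw [eps_tameWild κ n θ β hβ ψ₀ h₀ piVal]
  have hθβ : (θ β)⁻¹ = θ β := inv_eq_of_mul_eq_one_right hθ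
  have hval : piVal ^ n * κ * ((Fintype.card k : ℂ) * (θ β)⁻¹) = piVal ^ n * θ β := by
    rw [hθβ]
    calc piVal ^ n * κ * ((Fintype.card k : ℂ) * θ β) = piVal ^ n * (κ * (Fintype.card k : ℂ)) * θ β := by ring
      _ = piVal ^ n * θ β := by rw [hκ, mul_one]
  rw [hval]
  rcases hπ with h | h <;> rw [h]
  · -- `θ(β) = ±1`
    rcases mul_self_eq_one_iff.1 hθ with h1 | h1
    · left; rw [h1, one_mul]
    · right; rw [h1, one_mul]
  · rcases mul_self_eq_one_iff.1 hθ with h1 | h1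
    · right; rw [h1, neg_one_mul]
    · left; rw [h1, neg_one_mul, neg_neg]

end GaussSum

/-! ### The numbers at `𝔭₁, 𝔭₂ | 5` -/

/-- `5` is prime (so that `ZMod 5 = 𝔽₅` is a field). -/
instance fact_prime_five : Fact (Nat.Prime 5) := ⟨by norm_num⟩

/-- `|𝒪/𝔭²| = 25 = q_K²` at `𝔭₁, 𝔭₂ | 5` (`octic_p1.qK = octic_p2.qK = 5`). -/
theorem card_dual_p5 : Fintype.card (DualNumber (ZMod 5)) = octic_p1.qK ^ 2 ∧
    Fintype.card (DualNumber (ZMod 5)) = octic_p2.qK ^ 2 := by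
  rw [card_dualNumber, ZMod.card]
  exact ⟨rfl, rfl⟩

/-- The `s = ½` constant at `𝔭₁, 𝔭₂ | 5`, conductor `2`: `|R|^{−1/2} = 25^{−1/2} = 1/5` (`kappaHalf`, written out). -/
theorem sqrt_card_dual_p5 : ((Real.sqrt (Fintype.card (DualNumber (ZMod 5))))⁻¹ : ℝ) = 1 / 5 := by
  rw [card_dualNumber, ZMod.card]
  have : Real.sqrt ((5 : ℕ) ^ 2 : ℕ) = 5 := by
    rw [Nat.cast_pow, Nat.cast_ofNat, Real.sqrt_sq (by norm_num)]
  rw [this, one_div]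

/-- `κ · |k| = 1` at `𝔭₁, 𝔭₂ | 5` for `κ = 1/5`: the hypothesis `hκ` of `eps_tameWild_sign` in numbers. -/
theorem kappa_mul_card_p5 : ((1 / 5 : ℝ) : ℂ) * (Fintype.card (ZMod 5) : ℂ) = 1 := by
  rw [ZMod.card]
  norm_num

end DualModel

end Summit.Ventures.HodgeRepro.PeriodCloser

end
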